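import Summits.Ventures.PackingBounds.Energy.CrossPolytopeUniversal
import Summits.Ventures.PackingBounds.Energy.TangentLineUniversal

/-!
# The `|x - y|⁻⁶` energy: cross-polytope and simplex bounds in EVERY dimension `n ≥ 3`

Framing: lottery ticket; floor = certified bounds/negative ranges. Venture `PackingBounds` (cell
`pub-packcert`, seat `pub-packcert-energy`), energy-minimisation family, **universal + controls**
(one theorem for all dimensions; the per-dimension files `DimensionThreeOctahedron.lean` (27/2)
and the sharp simplex rows are the instances `n = 3, 4, …`).

For the potential `a(t) = (2 - 2t)⁻³ = |x - y|⁻⁶` (`u = 2 - 2t`):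

* **Cross-polytope.** `a(0) = 1/8`, `a'(0) = 3/8`, `a(-1) = 1/64`, `κ = 17/64`; Hermite minorant
  `q(t) = 1/8 + 3t/8 + 17t²/64`, and `1 - u³ q(t) = t² (1 + t) (17t² - 44t + 31) / 8 ≥ 0` on
  `[-1, 1]` (the quadratic has negative discriminant); by `crossPolytope_energy_ge` every `2n` unit
  vectors of `ℝⁿ` have `Σ_{x ≠ y} |x - y|⁻⁶ ≥ 2n (2(n-1)/8 + 1/64) = n(n-1)/2 + n/32`
  (cross-polytope: `n = 3`: `99/32`).
* **Simplex.** Tangent line at `t₀ = -1/(N-1)`, `u₀ = 2N/(N-1)`: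
  `a(t) - a(t₀) - a'(t₀)(t - t₀) = (u₀ - u)² (u₀² + 2u₀u + 3u²) / (u³ u₀⁴) ≥ 0`; `tangent_energy_ge`
  gives `Σ_{x ≠ y} |x - y|⁻⁶ ≥ N (N-1) u₀⁻³ = (N-1)⁴ / (8N²)` for every `N ≥ 2`, sharp for the
  regular simplex when `N ≤ n + 1` (`N = 4`: `81/128`).

## References
* H. Cohn, A. Kumar, J. Amer. Math. Soc. 20 (2007) 99–148, Thm. 1.2, Table 1. [`CohnKumar2006`]
-/

namespace Summit.Ventures.PackingBounds.Energy

open Finset Literature.Analysis.SpecialFunctions Literature.Geometry.DiscreteGeometry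

open scoped Classical in
/-- **Cross-polytope bound for the `|x-y|⁻⁶` energy, all dimensions**: for `n ≥ 3`, every `2n`
unit vectors of `ℝⁿ` have `Σ_{x ≠ y} |x - y|⁻⁶ ≥ n(n-1)/2 + n/32`, with equality for the regular
cross-polytope. [cite: CohnKumar2006, Theorem 1.2 and Proposition 4.1] -/
theorem crossPolytope_riesz6_energy_ge {n : ℕ} (hn : 3 ≤ n)
    (C : Finset (EuclideanSpace ℝ (Fin n))) (h1 : ∀ x ∈ C, ‖x‖ = 1) (hN : C.card = 2 * n) :
    (n : ℝ) * ((n : ℝ) - 1) / 2 + n / 32 ≤ ∑ x ∈ C, ∑ y ∈ C.erase x, ((‖x - y‖ ^ 2)⁻¹) ^ 3 := by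
  have hn3 : (3 : ℝ) ≤ n := by exact_mod_cast hn
  have key := crossPolytope_energy_ge hn (fun t : ℝ => ((2 - 2 * t)⁻¹) ^ 3) (3 / 8) (by norm_num)
    (by norm_num) (by norm_num; positivity) ?_ C h1 hN
  · have hconv : ∑ x ∈ C, ∑ y ∈ C.erase x, (fun t : ℝ => ((2 - 2 * t)⁻¹) ^ 3) (inner ℝ x y) =
        ∑ x ∈ C, ∑ y ∈ C.erase x, ((‖x - y‖ ^ 2)⁻¹) ^ 3 := by
      refine Finset.sum_congr rfl fun x hx => Finset.sum_congr rfl fun y hy => ?_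
      have hyC : y ∈ C := Finset.mem_of_mem_erase hy
      have hsq : ‖x - y‖ ^ 2 = 2 - 2 * inner ℝ x y := by
        rw [@norm_sub_sq_real, h1 x hx, h1 y hyC]; ring
      show ((2 - 2 * inner ℝ x y)⁻¹) ^ 3 = ((‖x - y‖ ^ 2)⁻¹) ^ 3
      rw [hsq]
    rw [hconv] at key
    refine le_trans (le_of_eq ?_) key
    norm_num
    ring
  · intro t ht1 ht2
    show ((2 - 2 * (0 : ℝ))⁻¹) ^ 3 + 3 / 8 * t +
        (((2 - 2 * (-1 : ℝ))⁻¹) ^ 3 - ((2 - 2 * (0 : ℝ))⁻¹) ^ 3 + 3 / 8) * t ^ 2 ≤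
        ((2 - 2 * t)⁻¹) ^ 3
    have hpos : (0 : ℝ) < 2 - 2 * t := by linarith
    simp only [inv_pow]
    rw [show (((2 : ℝ) - 2 * t) ^ 3)⁻¹ = 1 / ((2 - 2 * t) ^ 3) from inv_eq_one_div _,
      le_div_iff₀ (pow_pos hpos 3)]
    norm_num
    have hquad : (0 : ℝ) ≤ 17 * t ^ 2 - 44 * t + 31 := by nlinarith [sq_nonneg (17 * t - 22)]
    nlinarith [mul_nonneg (mul_nonneg (sq_nonneg t) (by linarith : (0 : ℝ) ≤ t + 1)) hquad]

open scoped Classical in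
/-- **Simplex / Jensen bound for the `|x-y|⁻⁶` energy, all dimensions**: for `n ≥ 3` and `N ≥ 2`,
every `N` unit vectors of `ℝⁿ` have `Σ_{x ≠ y} |x - y|⁻⁶ ≥ (N-1)⁴/(8N²)`, with equality for the
regular simplex when `N ≤ n + 1`. [cite: CohnKumar2006, Theorem 1.2 and Proposition 4.1] -/
theorem simplex_riesz6_energy_ge {n : ℕ} (hn : 3 ≤ n) (N : ℕ) (hN2 : 2 ≤ N)
    (C : Finset (EuclideanSpace ℝ (Fin n))) (h1 : ∀ x ∈ C, ‖x‖ = 1) (hN : C.card = N) :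
    ((N : ℝ) - 1) ^ 4 / (8 * N ^ 2) ≤ ∑ x ∈ C, ∑ y ∈ C.erase x, ((‖x - y‖ ^ 2)⁻¹) ^ 3 := by
  have hN2' : (2 : ℝ) ≤ N := by exact_mod_cast hN2
  have hN1 : (0 : ℝ) < (N : ℝ) - 1 := by linarith
  -- tangent line of a(t) = (2-2t)⁻³ at t₀ = -1/(N-1): u₀ = 2N/(N-1), a(t₀) = u₀⁻³, slope 6 u₀⁻⁴
  have hNpos : (0 : ℝ) < N := by linarith
  set u₀ : ℝ := 2 + 2 / ((N : ℝ) - 1) with hu₀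
  have hu₀pos : 0 < u₀ := by rw [hu₀]; positivity
  have ha_t0 : ((2 - 2 * (-1 / ((N : ℝ) - 1)))⁻¹) ^ 3 = (u₀⁻¹) ^ 3 := by
    rw [hu₀]; ring_nf
  set m : ℝ := 6 / u₀ ^ 4 with hm
  have hmnn : 0 ≤ m := by rw [hm]; positivity
  have key := tangent_energy_ge hn N hN2 (fun t : ℝ => ((2 - 2 * t)⁻¹) ^ 3) m hmnn ?_ ?_ C h1 hN
  · have hconv : ∑ x ∈ C, ∑ y ∈ C.erase x, (fun t : ℝ => ((2 - 2 * t)⁻¹) ^ 3) (inner ℝ x y) =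
        ∑ x ∈ C, ∑ y ∈ C.erase x, ((‖x - y‖ ^ 2)⁻¹) ^ 3 := by
      refine Finset.sum_congr rfl fun x hx => Finset.sum_congr rfl fun y hy => ?_
      have hyC : y ∈ C := Finset.mem_of_mem_erase hy
      have hsq : ‖x - y‖ ^ 2 = 2 - 2 * inner ℝ x y := by
        rw [@norm_sub_sq_real, h1 x hx, h1 y hyC]; ring
      show ((2 - 2 * inner ℝ x y)⁻¹) ^ 3 = ((‖x - y‖ ^ 2)⁻¹) ^ 3
      rw [hsq]
    rw [hconv, ha_t0] at key
    refine le_trans (le_of_eq ?_) key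
    rw [hu₀]
    field_simp
    ring
  · -- supporting line: a(t₀) + m (t - t₀) ≤ a(t) on [-1, 1)
    intro t ht1 ht2
    rw [ha_t0]
    show (u₀⁻¹) ^ 3 + m * (t + 1 / ((N : ℝ) - 1)) ≤ ((2 - 2 * t)⁻¹) ^ 3
    have hpos : (0 : ℝ) < 2 - 2 * t := by linarith
    have ht0 : t + 1 / ((N : ℝ) - 1) = (u₀ - (2 - 2 * t)) / 2 := by rw [hu₀]; ring
    rw [ht0, hm]
    simp only [inv_pow]
    rw [show (((2 : ℝ) - 2 * t) ^ 3)⁻¹ = 1 / ((2 - 2 * t) ^ 3) from inv_eq_one_div _,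
      le_div_iff₀ (pow_pos hpos 3)]
    have hu0ne : u₀ ≠ 0 := hu₀pos.ne'
    have hexp : ((u₀ ^ 3)⁻¹ + 6 / u₀ ^ 4 * ((u₀ - (2 - 2 * t)) / 2)) * (2 - 2 * t) ^ 3 =
        1 - (u₀ - (2 - 2 * t)) ^ 2 * (u₀ ^ 2 + 2 * u₀ * (2 - 2 * t) + 3 * (2 - 2 * t) ^ 2) /
          u₀ ^ 4 := by
      field_simp
      ring
    rw [hexp]
    have hsq : 0 ≤ (u₀ - (2 - 2 * t)) ^ 2 * (u₀ ^ 2 + 2 * u₀ * (2 - 2 * t) + 3 * (2 - 2 * t) ^ 2) /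
        u₀ ^ 4 := by positivity
    linarith
  · -- a(t₀) + m/(N-1) ≥ 0
    rw [ha_t0]
    positivity

end Summit.Ventures.PackingBounds.Energy
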